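import Mathlib
import Literature.NumberTheory.Irrationality.Zudilin2003.CatalanRemarks
import HarnessLib

/-!
# Zudilin's "remarks" note, Theorem 2 — term-wise bounds for the series of the linear forms `ũ_nG − ṽ_n`

For the second Apéry-like construction of [Zudilin2002CatalanRemarks, Sect. 2, Theorem 2]
(`Literature.…Zudilin2003.{RT, uT, vT, formT, remarksTheorem2}`) the sequel files identify the limit of
`ṽ_n/ũ_n` with Catalan's constant `G`.  Since `G − ṽ_n/ũ_n = (ũ_nG − ṽ_n)/ũ_n` and `ũ_n` grows like
`((1+√5)/2)^{5n} ≈ 11.09ⁿ` (`CatalanRemarksTGrowth.lean`), any bound `|ũ_nG − ṽ_n| ≤ C·n^a·bⁿ` with `b < 19/2`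
suffices.  Such a bound with `b = 4` follows from the series representation
`ũ_nG − ṽ_n = −Σ_{ν≥0} R̃′_n(ν+1)` (`remarksTheorem2_series` of `CatalanRemarksTSeries.lean`, eq. (12) of the
note) and the ELEMENTARY term-wise estimates proved here for the rational function `R̃_n(t) = c̃_n · Π_{j<n-1}(t−j−1) · Π_{j<n}(t−j−1) / Π_{j≤2n}(2t+j−n−½)`,
`c̃_n = (−1)ⁿ(2n)!/(2((n−1)!)²)`, at the positive integers `m`:

* `deriv_RT_eq_zero` — `R̃′_n(m) = 0` for `1 ≤ m ≤ n − 1` (double zeros);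
* `abs_deriv_RT_top_le` — `|R̃′_n(n)| ≤ 8|c̃_n|` (simple zero at `t = n`);
* `abs_deriv_RT_far_le` — `|R̃′_n(m)| ≤ |c̃_n|(4n)/m²` for `m ≥ n + 1` (logarithmic derivative on `t > n`);
* `abs_deriv_RT_le` — uniformly, **`|R̃′_n(ν+1)| ≤ 8|c̃_n|n²/(ν+1)²`** for every `ν ≥ 0`.

The sequel `CatalanRemarksTLimit.lean` sums this against `ζ(2)` (`|ũ_nG − ṽ_n| ≤ 7·n⁴·4ⁿ`).  The constants
are deliberately crude (the true size is `((√5−1)/2)^{5n}`); only `4 < 19/2` matters downstream.  This file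
uses nothing but the DEFINITION of `R̃_n` (`Zudilin2003.RT`) and Mathlib.

HONEST FRAMING: systematic search; no irrationality claim unless certified.  Nothing here bears on the
irrationality of Catalan's constant.
-/

open Filter Topology Finset
open Literature.NumberTheory.Irrationality.Zudilin2003

namespace Summit.KontsevichZagierPeriods.Zeta5Search.CatalanRemarksVT

/-! ### The pieces of `R̃_n` over `ℝ` -/

/-- The numerator block `Π_{j<n-1}(t − j − 1)` of `R̃_n`. [cite: Zudilin2002CatalanRemarks, Sect. 2, eq. (12)] -/
noncomputable def numRT (n : ℕ) (t : ℝ) : ℝ := ∏ j ∈ range (n - 1), (t - ((j : ℝ) + 1))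

/-- The denominator `Π_{j≤2n}(2t + j − n − ½)` of `R̃_n`. [cite: Zudilin2002CatalanRemarks, Sect. 2, eq. (12)] -/
noncomputable def denRT (n : ℕ) (t : ℝ) : ℝ := ∏ j ∈ range (2 * n + 1), (2 * t + (j : ℝ) - (n : ℝ) - 1 / 2)

/-- The constant `c̃_n = (−1)ⁿ(2n)!/(2((n−1)!)²)` of `R̃_n`. [cite: Zudilin2002CatalanRemarks, Sect. 2, eq. (12)] -/
noncomputable def cRT (n : ℕ) : ℝ :=
  (-1 : ℝ) ^ n / 2 * ((2 * n).factorial : ℝ) / (((n - 1).factorial : ℝ) ^ 2)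

/-- `R̃_{k+1}(t) = c̃ · N(t) · (N(t)(t − k − 1)) / D(t)`. [cite: Zudilin2002CatalanRemarks, Sect. 2, eq. (12)] -/
theorem RT_eq_pieces (k : ℕ) (t : ℝ) :
    RT (k + 1) t =
      cRT (k + 1) * numRT (k + 1) t * (numRT (k + 1) t * (t - ((k : ℝ) + 1))) / denRT (k + 1) t := by
  have h : (∏ j ∈ range (k + 1), (t - ((j : ℝ) + 1))) =
      (∏ j ∈ range k, (t - ((j : ℝ) + 1))) * (t - ((k : ℝ) + 1)) := by
    rw [Finset.prod_range_succ]
  unfold RT cRT numRT denRT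
  rw [h, Nat.add_sub_cancel]

/-- `N` is differentiable (a polynomial). [folklore] -/
theorem differentiableAt_numRT (n : ℕ) (x : ℝ) : DifferentiableAt ℝ (numRT n) x := by
  unfold numRT
  exact (HasDerivAt.fun_finsetProd (u := range (n - 1)) (x := x)
    (fun j _ => (hasDerivAt_id' x).sub_const ((j : ℝ) + 1))).differentiableAt

/-- `D` is differentiable (a polynomial). [folklore] -/
theorem differentiableAt_denRT (n : ℕ) (x : ℝ) : DifferentiableAt ℝ (denRT n) x := by
  unfold denRT
  exact (HasDerivAt.fun_finsetProd (u := range (2 * n + 1)) (x := x) (fun j _ =>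
    ((((hasDerivAt_id' x).const_mul (2 : ℝ)).add_const (j : ℝ)).sub_const (n : ℝ)).sub_const
      (1 / 2 : ℝ))).differentiableAt

/-- `D(m) ≠ 0` at every natural number `m` (its zeros are quarter-odd). [folklore] -/
theorem denRT_natCast_ne_zero (n m : ℕ) : denRT n (m : ℝ) ≠ 0 := by
  unfold denRT
  refine Finset.prod_ne_zero_iff.2 fun j _ h => ?_
  have h2 : ((4 * m + 2 * j : ℕ) : ℝ) = ((2 * n + 1 : ℕ) : ℝ) := by push_cast; linarith
  have h3 : 4 * m + 2 * j = 2 * n + 1 := by exact_mod_cast h2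
  omega

/-! ### `R̃′_n(m)` for `1 ≤ m ≤ n` -/

/-- Double zeros: `R̃′_{k+1}(m) = 0` for `1 ≤ m ≤ k`. [cite: Zudilin2002CatalanRemarks, Sect. 2, eq. (12)] -/
theorem deriv_RT_eq_zero (k m : ℕ) (hm1 : 1 ≤ m) (hmk : m ≤ k) :
    deriv (fun t : ℝ => RT (k + 1) t) (m : ℝ) = 0 := by
  have h0 : numRT (k + 1) (m : ℝ) = 0 := by
    unfold numRT
    rw [Nat.add_sub_cancel]
    exact Finset.prod_eq_zero (mem_range.2 (by omega : m - 1 < k))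
      (by rw [Nat.cast_sub hm1]; push_cast; ring)
  have hN := (differentiableAt_numRT (k + 1) (m : ℝ)).hasDerivAt
  have hD := (differentiableAt_denRT (k + 1) (m : ℝ)).hasDerivAt
  have hL : HasDerivAt (fun t : ℝ => t - ((k : ℝ) + 1)) 1 (m : ℝ) := (hasDerivAt_id' (m : ℝ)).sub_const _
  have h := ((hN.const_mul (cRT (k + 1))).fun_mul (hN.fun_mul hL)).fun_div hD
    (denRT_natCast_ne_zero (k + 1) m)
  have hfun : (fun t : ℝ => RT (k + 1) t) = fun t =>
      cRT (k + 1) * numRT (k + 1) t * (numRT (k + 1) t * (t - ((k : ℝ) + 1))) / denRT (k + 1) t := by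
    funext t; exact RT_eq_pieces k t
  rw [hfun, h.deriv, h0]
  simp

/-- Simple zero at `t = n`: `R̃′_{k+1}(k+1) = c̃ N(k+1)²/D(k+1)`. [cite: Zudilin2002CatalanRemarks, Sect. 2, eq. (12)] -/
theorem deriv_RT_top (k : ℕ) :
    deriv (fun t : ℝ => RT (k + 1) t) ((k : ℝ) + 1) =
      cRT (k + 1) * numRT (k + 1) ((k : ℝ) + 1) ^ 2 / denRT (k + 1) ((k : ℝ) + 1) := by
  have hN := (differentiableAt_numRT (k + 1) ((k : ℝ) + 1)).hasDerivAt
  have hD := (differentiableAt_denRT (k + 1) ((k : ℝ) + 1)).hasDerivAt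
  have hL : HasDerivAt (fun t : ℝ => t - ((k : ℝ) + 1)) 1 ((k : ℝ) + 1) := (hasDerivAt_id' _).sub_const _
  have hDne : denRT (k + 1) ((k : ℝ) + 1) ≠ 0 := by
    have := denRT_natCast_ne_zero (k + 1) (k + 1); push_cast at this; exact this
  have h := ((hN.const_mul (cRT (k + 1))).fun_mul (hN.fun_mul hL)).fun_div hD hDne
  have hfun : (fun t : ℝ => RT (k + 1) t) = fun t =>
      cRT (k + 1) * numRT (k + 1) t * (numRT (k + 1) t * (t - ((k : ℝ) + 1))) / denRT (k + 1) t := by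
    funext t; exact RT_eq_pieces k t
  rw [hfun, h.deriv, sub_self]
  field_simp
  ring

/-- `0 ≤ N(k+1) ≤ (k+½)^k`. [folklore] -/
theorem numRT_top_bounds (k : ℕ) :
    0 ≤ numRT (k + 1) ((k : ℝ) + 1) ∧ numRT (k + 1) ((k : ℝ) + 1) ≤ ((k : ℝ) + 1 / 2) ^ k := by
  unfold numRT
  rw [Nat.add_sub_cancel]
  have hnn : ∀ j ∈ range k, (0 : ℝ) ≤ (k : ℝ) + 1 - ((j : ℝ) + 1) := fun j hj => by
    have := mem_range.1 hj
    have : (j : ℝ) + 1 ≤ k := by exact_mod_cast this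
    linarith
  refine ⟨Finset.prod_nonneg hnn, ?_⟩
  calc (∏ j ∈ range k, ((k : ℝ) + 1 - ((j : ℝ) + 1)))
      ≤ ∏ _j ∈ range k, ((k : ℝ) + 1 / 2) :=
        Finset.prod_le_prod hnn fun j _ => by
          have : (0 : ℝ) ≤ j := by positivity
          linarith
    _ = ((k : ℝ) + 1 / 2) ^ k := by rw [Finset.prod_const, card_range]

/-- `(k+½)^{2k+3} ≤ D(k+1)`. [folklore] -/
theorem denRT_top_bound (k : ℕ) : ((k : ℝ) + 1 / 2) ^ (2 * k + 3) ≤ denRT (k + 1) ((k : ℝ) + 1) := by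
  unfold denRT
  calc ((k : ℝ) + 1 / 2) ^ (2 * k + 3) = ∏ _j ∈ range (2 * (k + 1) + 1), ((k : ℝ) + 1 / 2) := by
        rw [Finset.prod_const, card_range]; ring
    _ ≤ ∏ j ∈ range (2 * (k + 1) + 1), (2 * ((k : ℝ) + 1) + (j : ℝ) - ((k + 1 : ℕ) : ℝ) - 1 / 2) :=
        Finset.prod_le_prod (fun _ _ => by positivity) fun j _ => by
          push_cast
          have : (0 : ℝ) ≤ j := by positivity
          linarith

/-- **`|R̃′_{k+1}(k+1)| ≤ 8|c̃_{k+1}|`.** [cite: Zudilin2002CatalanRemarks, Sect. 2, eq. (12)] -/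
theorem abs_deriv_RT_top_le (k : ℕ) :
    |deriv (fun t : ℝ => RT (k + 1) t) ((k : ℝ) + 1)| ≤ 8 * |cRT (k + 1)| := by
  rw [deriv_RT_top]
  obtain ⟨hN0, hN⟩ := numRT_top_bounds k
  have hD := denRT_top_bound k
  set N := numRT (k + 1) ((k : ℝ) + 1)
  set D := denRT (k + 1) ((k : ℝ) + 1)
  set X := (k : ℝ) + 1 / 2 with hX
  have hX2 : 1 / 2 ≤ X := by
    rw [hX]
    have : (0 : ℝ) ≤ k := by positivity
    linarith
  have hXpos : 0 < X := by linarith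
  have hDpos : 0 < D := lt_of_lt_of_le (by positivity) hD
  have hN2 : N ^ 2 ≤ X ^ (2 * k) := by
    calc N ^ 2 ≤ (X ^ k) ^ 2 := pow_le_pow_left₀ hN0 hN 2
      _ = X ^ (2 * k) := by rw [← pow_mul, mul_comm]
  have hX3 : 1 ≤ 8 * X ^ 3 := by
    have := pow_le_pow_left₀ (by norm_num : (0 : ℝ) ≤ 1 / 2) hX2 3
    norm_num at this
    linarith
  have hND : N ^ 2 ≤ 8 * D := by
    calc N ^ 2 ≤ X ^ (2 * k) := hN2
      _ ≤ X ^ (2 * k) * (8 * X ^ 3) := le_mul_of_one_le_right (by positivity) hX3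
      _ = 8 * X ^ (2 * k + 3) := by ring
      _ ≤ 8 * D := by linarith
  rw [abs_div, abs_mul, abs_of_nonneg (by positivity : (0 : ℝ) ≤ N ^ 2), abs_of_pos hDpos,
    div_le_iff₀ hDpos]
  nlinarith [abs_nonneg (cRT (k + 1))]

/-! ### `R̃′_n(m)` for `m ≥ n + 1`: the logarithmic derivative -/

/-- `log (R̃_{k+1}(t)/c̃_{k+1})` for `t > k + 1`. [cite: Zudilin2002CatalanRemarks, Sect. 2, eq. (12)] -/
noncomputable def logRT (k : ℕ) (t : ℝ) : ℝ :=
  (∑ j ∈ range k, Real.log (t - ((j : ℝ) + 1))) + (∑ j ∈ range (k + 1), Real.log (t - ((j : ℝ) + 1)))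
    - ∑ j ∈ range (2 * (k + 1) + 1), Real.log (2 * t + (j : ℝ) - ((k + 1 : ℕ) : ℝ) - 1 / 2)

/-- The logarithmic derivative of `R̃_{k+1}` at the natural number `m`. [cite: Zudilin2002CatalanRemarks, Sect. 2, eq. (12)] -/
noncomputable def dlogRT (k m : ℕ) : ℝ :=
  (∑ j ∈ range k, 1 / ((m : ℝ) - ((j : ℝ) + 1))) + (∑ j ∈ range (k + 1), 1 / ((m : ℝ) - ((j : ℝ) + 1)))
    - ∑ j ∈ range (2 * (k + 1) + 1), 2 / (2 * (m : ℝ) + (j : ℝ) - ((k + 1 : ℕ) : ℝ) - 1 / 2)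

/-- `R̃_{k+1}(t) = c̃ · exp(logRT k t)` for `t > k + 1`. [cite: Zudilin2002CatalanRemarks, Sect. 2, eq. (12)] -/
theorem RT_eq_exp (k : ℕ) (t : ℝ) (ht : (k : ℝ) + 1 < t) :
    RT (k + 1) t = cRT (k + 1) * Real.exp (logRT k t) := by
  have hpos1 : ∀ j ∈ range (k + 1), 0 < t - ((j : ℝ) + 1) := fun j hj => by
    have := mem_range.1 hj
    have : (j : ℝ) ≤ k := by exact_mod_cast Nat.lt_succ_iff.1 this
    linarith
  have hpos0 : ∀ j ∈ range k, 0 < t - ((j : ℝ) + 1) := fun j hj =>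
    hpos1 j (mem_range.2 (by have := mem_range.1 hj; omega))
  have hpos2 : ∀ j ∈ range (2 * (k + 1) + 1), 0 < 2 * t + (j : ℝ) - ((k + 1 : ℕ) : ℝ) - 1 / 2 :=
    fun j _ => by
      push_cast
      have : (0 : ℝ) ≤ j := by positivity
      linarith
  unfold logRT
  rw [Real.exp_sub, Real.exp_add, Real.exp_sum, Real.exp_sum, Real.exp_sum,
    Finset.prod_congr rfl fun j hj => Real.exp_log (hpos0 j hj),
    Finset.prod_congr rfl fun j hj => Real.exp_log (hpos1 j hj),
    Finset.prod_congr rfl fun j hj => Real.exp_log (hpos2 j hj)]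
  unfold RT cRT
  rw [Nat.add_sub_cancel]
  ring

/-- `logRT k` has derivative `dlogRT k m` at the natural number `m ≥ k + 2`. [folklore] -/
theorem hasDerivAt_logRT (k m : ℕ) (hm : k + 2 ≤ m) :
    HasDerivAt (logRT k) (dlogRT k m) (m : ℝ) := by
  have hm' : (k : ℝ) + 2 ≤ m := by exact_mod_cast hm
  unfold logRT dlogRT
  refine HasDerivAt.sub (HasDerivAt.add (HasDerivAt.fun_sum fun j hj => ?_)
    (HasDerivAt.fun_sum fun j hj => ?_)) (HasDerivAt.fun_sum fun j hj => ?_)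
  · have hne : (m : ℝ) - ((j : ℝ) + 1) ≠ 0 := by
      have := mem_range.1 hj
      have : (j : ℝ) + 1 ≤ k := by exact_mod_cast this
      linarith
    exact ((hasDerivAt_id' (m : ℝ)).sub_const _).log hne
  · have hne : (m : ℝ) - ((j : ℝ) + 1) ≠ 0 := by
      have := mem_range.1 hj
      have : (j : ℝ) ≤ k := by exact_mod_cast Nat.lt_succ_iff.1 this
      linarith
    exact ((hasDerivAt_id' (m : ℝ)).sub_const _).log hne
  · have hne : 2 * (m : ℝ) + (j : ℝ) - ((k + 1 : ℕ) : ℝ) - 1 / 2 ≠ 0 := by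
      push_cast
      have : (0 : ℝ) ≤ j := by positivity
      linarith
    have h2 : HasDerivAt (fun y : ℝ => 2 * y + (j : ℝ) - ((k + 1 : ℕ) : ℝ) - 1 / 2) 2 (m : ℝ) := by
      simpa using ((((hasDerivAt_id' (m : ℝ)).const_mul (2 : ℝ)).add_const (j : ℝ)).sub_const
        ((k + 1 : ℕ) : ℝ)).sub_const (1 / 2 : ℝ)
    exact h2.log hne

/-- `R̃′_{k+1}(m) = R̃_{k+1}(m) · dlogRT k m` for `m ≥ k + 2`. [cite: Zudilin2002CatalanRemarks, Sect. 2, eq. (12)] -/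
theorem deriv_RT_far (k m : ℕ) (hm : k + 2 ≤ m) :
    deriv (fun t : ℝ => RT (k + 1) t) (m : ℝ) = RT (k + 1) (m : ℝ) * dlogRT k m := by
  have hm' : (k : ℝ) + 1 < m := by
    have : ((k + 2 : ℕ) : ℝ) ≤ m := by exact_mod_cast hm
    push_cast at this
    linarith
  have h := ((hasDerivAt_logRT k m hm).exp).const_mul (cRT (k + 1))
  have hev : (fun t : ℝ => RT (k + 1) t) =ᶠ[𝓝 (m : ℝ)] fun t => cRT (k + 1) * Real.exp (logRT k t) :=
    Filter.eventuallyEq_of_mem (Ioi_mem_nhds hm') fun t ht => RT_eq_exp k t ht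
  rw [hev.deriv_eq, h.deriv, RT_eq_exp k m hm']
  ring

/-- `|dlogRT k m| ≤ 4k + 4` for `m ≥ k + 2` (each of the `4k+4` terms lies in `[0,1]`). [folklore] -/
theorem abs_dlogRT_le (k m : ℕ) (hm : k + 2 ≤ m) : |dlogRT k m| ≤ 4 * (k : ℝ) + 4 := by
  have hm' : (k : ℝ) + 2 ≤ m := by exact_mod_cast hm
  have hb : ∀ j ∈ range (k + 1),
      0 ≤ 1 / ((m : ℝ) - ((j : ℝ) + 1)) ∧ 1 / ((m : ℝ) - ((j : ℝ) + 1)) ≤ 1 := fun j hj => by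
    have := mem_range.1 hj
    have : (j : ℝ) ≤ k := by exact_mod_cast Nat.lt_succ_iff.1 this
    have h1 : 1 ≤ (m : ℝ) - ((j : ℝ) + 1) := by linarith
    exact ⟨by positivity, (div_le_one (by linarith)).2 h1⟩
  have hb' : ∀ j ∈ range k,
      0 ≤ 1 / ((m : ℝ) - ((j : ℝ) + 1)) ∧ 1 / ((m : ℝ) - ((j : ℝ) + 1)) ≤ 1 := fun j hj =>
    hb j (mem_range.2 (by have := mem_range.1 hj; omega))
  have hc : ∀ j ∈ range (2 * (k + 1) + 1),
      0 ≤ 2 / (2 * (m : ℝ) + (j : ℝ) - ((k + 1 : ℕ) : ℝ) - 1 / 2) ∧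
        2 / (2 * (m : ℝ) + (j : ℝ) - ((k + 1 : ℕ) : ℝ) - 1 / 2) ≤ 1 := fun j _ => by
    push_cast
    have : (0 : ℝ) ≤ j := by positivity
    have h1 : 2 ≤ 2 * (m : ℝ) + (j : ℝ) - ((k : ℝ) + 1) - 1 / 2 := by linarith
    exact ⟨by positivity, (div_le_one (by linarith)).2 h1⟩
  have h0l : 0 ≤ ∑ j ∈ range k, 1 / ((m : ℝ) - ((j : ℝ) + 1)) :=
    Finset.sum_nonneg fun j hj => (hb' j hj).1
  have h0u : (∑ j ∈ range k, 1 / ((m : ℝ) - ((j : ℝ) + 1))) ≤ k := by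
    have := Finset.sum_le_card_nsmul (range k) (fun j => 1 / ((m : ℝ) - ((j : ℝ) + 1))) 1
      fun j hj => (hb' j hj).2
    rw [card_range, nsmul_eq_mul, mul_one] at this
    exact this
  have h1l : 0 ≤ ∑ j ∈ range (k + 1), 1 / ((m : ℝ) - ((j : ℝ) + 1)) :=
    Finset.sum_nonneg fun j hj => (hb j hj).1
  have h1u : (∑ j ∈ range (k + 1), 1 / ((m : ℝ) - ((j : ℝ) + 1))) ≤ (k : ℝ) + 1 := by
    have := Finset.sum_le_card_nsmul (range (k + 1)) (fun j => 1 / ((m : ℝ) - ((j : ℝ) + 1))) 1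
      fun j hj => (hb j hj).2
    rw [card_range, nsmul_eq_mul, mul_one] at this
    push_cast at this
    exact this
  have h2l : 0 ≤ ∑ j ∈ range (2 * (k + 1) + 1), 2 / (2 * (m : ℝ) + (j : ℝ) - ((k + 1 : ℕ) : ℝ) - 1 / 2) :=
    Finset.sum_nonneg fun j hj => (hc j hj).1
  have h2u : (∑ j ∈ range (2 * (k + 1) + 1), 2 / (2 * (m : ℝ) + (j : ℝ) - ((k + 1 : ℕ) : ℝ) - 1 / 2))
      ≤ 2 * (k : ℝ) + 3 := by
    have := Finset.sum_le_card_nsmul (range (2 * (k + 1) + 1))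
      (fun j => 2 / (2 * (m : ℝ) + (j : ℝ) - ((k + 1 : ℕ) : ℝ) - 1 / 2)) 1 fun j hj => (hc j hj).2
    rw [card_range, nsmul_eq_mul, mul_one] at this
    have e : ((2 * (k + 1) + 1 : ℕ) : ℝ) = 2 * (k : ℝ) + 3 := by push_cast; ring
    rw [e] at this
    exact this
  unfold dlogRT
  exact abs_le.2 ⟨by linarith, by linarith⟩

/-- `|R̃_{k+1}(m)| ≤ |c̃_{k+1}|/m²` for `m ≥ k + 2`. [cite: Zudilin2002CatalanRemarks, Sect. 2, eq. (12)] -/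
theorem abs_RT_far_le (k m : ℕ) (hm : k + 2 ≤ m) :
    |RT (k + 1) (m : ℝ)| ≤ |cRT (k + 1)| / (m : ℝ) ^ 2 := by
  have hm' : (k : ℝ) + 2 ≤ m := by exact_mod_cast hm
  have hmpos : (0 : ℝ) < m := by linarith
  rw [RT_eq_pieces]
  have hnn : ∀ j ∈ range k, (0 : ℝ) ≤ (m : ℝ) - ((j : ℝ) + 1) := fun j hj => by
    have := mem_range.1 hj
    have : (j : ℝ) + 1 ≤ k := by exact_mod_cast this
    linarith
  have hN0 : 0 ≤ numRT (k + 1) (m : ℝ) := by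
    unfold numRT; rw [Nat.add_sub_cancel]; exact Finset.prod_nonneg hnn
  have hN : numRT (k + 1) (m : ℝ) ≤ (m : ℝ) ^ k := by
    unfold numRT
    rw [Nat.add_sub_cancel]
    calc (∏ j ∈ range k, ((m : ℝ) - ((j : ℝ) + 1))) ≤ ∏ _j ∈ range k, (m : ℝ) :=
          Finset.prod_le_prod hnn fun j _ => by
            have : (0 : ℝ) ≤ j := by positivity
            linarith
      _ = (m : ℝ) ^ k := by rw [Finset.prod_const, card_range]
  have hL0 : 0 ≤ (m : ℝ) - ((k : ℝ) + 1) := by linarith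
  have hL : (m : ℝ) - ((k : ℝ) + 1) ≤ m := by linarith
  have hD : (m : ℝ) ^ (2 * k + 3) ≤ denRT (k + 1) (m : ℝ) := by
    unfold denRT
    calc (m : ℝ) ^ (2 * k + 3) = ∏ _j ∈ range (2 * (k + 1) + 1), (m : ℝ) := by
          rw [Finset.prod_const, card_range]; ring
      _ ≤ ∏ j ∈ range (2 * (k + 1) + 1), (2 * (m : ℝ) + (j : ℝ) - ((k + 1 : ℕ) : ℝ) - 1 / 2) :=
          Finset.prod_le_prod (fun _ _ => by positivity) fun j _ => by
            push_cast
            have : (0 : ℝ) ≤ j := by positivity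
            linarith
  have hDpos : 0 < denRT (k + 1) (m : ℝ) := lt_of_lt_of_le (by positivity) hD
  rw [abs_div, abs_mul, abs_mul, abs_mul, abs_of_nonneg hN0, abs_of_nonneg hL0, abs_of_pos hDpos,
    div_le_div_iff₀ hDpos (by positivity)]
  calc |cRT (k + 1)| * numRT (k + 1) (m : ℝ) * (numRT (k + 1) (m : ℝ) * ((m : ℝ) - ((k : ℝ) + 1)))
        * (m : ℝ) ^ 2
      ≤ |cRT (k + 1)| * (m : ℝ) ^ k * ((m : ℝ) ^ k * (m : ℝ)) * (m : ℝ) ^ 2 := by gcongr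
    _ = |cRT (k + 1)| * (m : ℝ) ^ (2 * k + 3) := by ring
    _ ≤ |cRT (k + 1)| * denRT (k + 1) (m : ℝ) := mul_le_mul_of_nonneg_left hD (abs_nonneg _)

/-- **`|R̃′_{k+1}(m)| ≤ |c̃_{k+1}|(4k+4)/m²` for `m ≥ k + 2`.** [cite: Zudilin2002CatalanRemarks, Sect. 2, eq. (12)] -/
theorem abs_deriv_RT_far_le (k m : ℕ) (hm : k + 2 ≤ m) :
    |deriv (fun t : ℝ => RT (k + 1) t) (m : ℝ)| ≤ |cRT (k + 1)| * (4 * (k : ℝ) + 4) / (m : ℝ) ^ 2 := by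
  rw [deriv_RT_far k m hm, abs_mul, mul_div_right_comm]
  exact mul_le_mul (abs_RT_far_le k m hm) (abs_dlogRT_le k m hm) (abs_nonneg _) (by positivity)

/-! ### The uniform domination -/

/-- **Uniform domination: `|R̃′_{k+1}(ν+1)| ≤ 8|c̃_{k+1}|(k+1)²/(ν+1)²` for every `ν ≥ 0`.**
[cite: Zudilin2002CatalanRemarks, Sect. 2, eq. (12)] -/
theorem abs_deriv_RT_le (k ν : ℕ) :
    |deriv (fun t : ℝ => RT (k + 1) t) ((ν : ℝ) + 1)| ≤
      8 * |cRT (k + 1)| * ((k : ℝ) + 1) ^ 2 / ((ν : ℝ) + 1) ^ 2 := by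
  have hcast : ((ν : ℝ) + 1) = ((ν + 1 : ℕ) : ℝ) := by push_cast; ring
  rcases lt_trichotomy (ν + 1) (k + 1) with hlt | heq | hgt
  · rw [hcast, deriv_RT_eq_zero k (ν + 1) (by omega) (by omega), abs_zero]
    positivity
  · have hν : ν = k := by omega
    subst hν
    have hpos : (0 : ℝ) < ((ν : ℝ) + 1) ^ 2 := by positivity
    calc |deriv (fun t : ℝ => RT (ν + 1) t) ((ν : ℝ) + 1)| ≤ 8 * |cRT (ν + 1)| := abs_deriv_RT_top_le ν
      _ = 8 * |cRT (ν + 1)| * ((ν : ℝ) + 1) ^ 2 / ((ν : ℝ) + 1) ^ 2 := by field_simp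
  · rw [hcast]
    calc |deriv (fun t : ℝ => RT (k + 1) t) ((ν + 1 : ℕ) : ℝ)|
        ≤ |cRT (k + 1)| * (4 * (k : ℝ) + 4) / ((ν + 1 : ℕ) : ℝ) ^ 2 := abs_deriv_RT_far_le k (ν + 1) (by omega)
      _ ≤ 8 * |cRT (k + 1)| * ((k : ℝ) + 1) ^ 2 / ((ν + 1 : ℕ) : ℝ) ^ 2 := by
          apply div_le_div_of_nonneg_right _ (by positivity)
          have h1 : (0 : ℝ) ≤ |cRT (k + 1)| * (8 * (k : ℝ) ^ 2 + 12 * k + 4) := by positivity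
          linarith [h1]

end Summit.KontsevichZagierPeriods.Zeta5Search.CatalanRemarksVT
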